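import Literature.AlgebraicGeometry.Milne1999.LefschetzCentraliserCM
import Literature.AlgebraicGeometry.Milne1999.SpecialLefschetzGroupOneEqUnitaryCentralizer
import Literature.AlgebraicGeometry.ComplexMultiplication.RosatiPolarizationCM
import Literature.AlgebraicGeometry.Pohlmann1968.DivisorClassesCMType
import Literature.AlgebraicGeometry.Pohlmann1968.MumfordSimpleFourfoldOfPrimitive
import HarnessLib

/-!
# Milne 1999, Theorem 3.2 in the elementary case: the `S(A)`-invariants of a simple complex abelian
# variety of CM type are Lefschetz classes (the torus argument, p. 653 and Lemma 3.8)

Family `hodge`, layer `Literature/AlgebraicGeometry/Milne1999`, namespace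
`Literature.AlgebraicGeometry.Milne1999` (D-0022). THEOREMS ONLY (no definition, no named fact; D-0026).
Written for the cell `pub-hodgecm2` (COR-CM), seat `lit-milne`, binder table `HOME/lit/milne.md` rows
M2/M4 (Milne 1999a Thm. 3.2 / Cor. 4.5). The cited record
`Milne1999_specialLefschetzGroup_invariants_le` of `Milne1999/LefschetzGroup` (Cor. 4.5 with Thm. 4.4 and
Thm. 3.2: for EVERY complex abelian variety, the classes of `H²ᵖ(A(ℂ); ℂ)` fixed by
`specialLefschetzGroup (dim A) A.X` lie in `Dᵖ_hom(A)_ℂ`) rests, for a general `A`, on the first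
fundamental theorem of invariant theory for `Sp`, `O`, `GL` (Prop. 3.6) and stays a cited record. This file
PROVES its conclusion in the case Milne himself singles out as "so much more elementary than the general
case" — `S(A)` a torus — which over `ℂ` is the case of a simple abelian variety of CM type
(`End⁰(A) = K` a CM field of degree `2 dim A`).

## Source, verbatim

J. S. Milne, *Lefschetz classes on abelian varieties*, Duke Math. J. 96 (1999) 639–675
[`paper:doi-10-1215-s0012-7094-99-09620-5`, held; PDF page = printed page − 638]:

* Thm. 3.2 (p. 653, p0015 L22–23): "Theorem 3.2. For any abelian variety `A` over `Ω` and integer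
  `r ≥ 0`, the `k`-algebra `H*(A^r)^{S(A)}` is generated by divisor classes."; Prop. 3.3 (degree `2`) and
  Prop. 3.4 (p0015 L27–32): "Proposition 3.4. For any abelian variety `A` over `Ω` and any integer `r`,
  `H*(A^r)^{S(A)} = k[H²(A^r)^{S(A)}]`."
* The elementary case (p. 656–657, p0018 L33 – p0019 L22): "Because it is so much more elementary than
  the general case, we explain the proof of Theorem 3.2 in the case of an abelian variety over the
  algebraic closure `F` of a finite field. […] **Lemma 3.8.** Let `Ξ` be the set of weights of `T` in `V`,
  and assume that the elements of `Ξ` can be numbered `ξ₁, …, ξ_{2m}` in such a way that the `ℤ`-module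
  of relations among the `ξᵢ` is generated by the relations `ξᵢ + ξ_{m+i} = 0`, `i = 1, …, m`. Then
  `(⋀V)^T` is generated as a `Ω`-algebra by `(⋀²V)^T`. […] If `A` is not a supersingular elliptic curve,
  then `K` is a CM-field, and `S(A)` is a torus. Every embedding `σ : K ↪ k^al` defines a character `ξ_σ`
  of `S(A)`, and the character group of `S(A)` is the quotient of `⊕ℤξ_σ` by the subgroup generated by
  the elements `ξ_σ + ξ_{ισ}`. Lemma 2.1 shows that `H¹(A^r) ⊗ k^al` is a free `K ⊗_ℚ k^al`-module.
  Therefore the weights of `S(A)` in `H¹(A) ⊗ k^al` are precisely the characters `ξ_σ`,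
  `σ ∈ Hom(K, k^al)`, and each has the same multiplicity. Choose a CM-type `{φ₁, ⋯, φ_m}` for `K`. Then
  the character group of `S(A)` has generators `{ξ_{φ₁}, …, ξ_{φ_m}, ξ_{ιφ₁}, …, ξ_{ιφ_m}}` and defining
  relations `ξ_{φᵢ} + ξ_{ιφᵢ} = 0`, `i = 1, …, m`. Here `ι` denotes complex conjugation. We can now apply
  Lemma 3.8 to deduce that `H*(A^r)^{S(A)}` is generated as a `k`-algebra by `H²(A^r)^{S(A)}`."
* Cor. 4.5 and p. 659 (p0021 L24–30): "Corollary 4.5. For any abelian variety `A` and any `r ≥ 0`,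
  `H^{2*}(A^r)(*)^{L(A)} = D_hom(A^r)_k`. […] the kernel of `l(A)`, regarded as a subgroup of `GL(V(A))`,
  equals `S(A)`."

## What is proved (the case `r = 1`, complex `A`, Betti cohomology, on the tree's carriers)

Data: a realisation `(A, ι, θ)` of a CM type `(K; Φ)` of a CM field `K` read on `H¹`
(`ComplexMultiplication.IsCMTypeRealisation Φ A ι θ`: `[K:ℚ] = 2 dim A`, `θ(a) = ι(a)^*`,
one-dimensional `σ`-eigenlines) with `θ(K) ⊆ C(A)` (`K` central in `End⁰(A)`, i.e. `End⁰(A) = K`: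
`IsCMTypeRealisation.theta_mem_centralizerAlgebra_of_comm` derives it from a commutative `End(A)`, the
case of a simple CM abelian variety).

* `exists_torusElement_unitaryCentralizerGroup` — **the cocharacters of `S(A)`**: for a Rosati-compatible
  polarization class `h` and every `φ : K → ℂ`, the automorphism `u_φ` of `H¹(A(ℂ); ℂ)` acting by `2` on
  the eigenline `H¹_φ`, by `2⁻¹` on `H¹_φ̄` and by `1` on the other eigenlines lies in
  `S(A)(ℂ) = unitaryCentralizerGroup A h` (it is diagonal, hence commutes with `θ(K)`, hence lies in
  `C(A)`; and `d_σ d_σ̄ = 1`) — the dual form of "generators `ξ_φ`, relations `ξ_φ + ξ_{ιφ} = 0`".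
* `exteriorPullback_monomial_eq_prod_smul` — **weights**: `⋀^{2p} u` multiplies the eigen-monomial
  `v_Δ = ⋀_{σ ∈ Δ} v_σ` of `H^{2p}(A(ℂ); ℂ) = ⋀^{2p} H¹` by `∏_{σ ∈ Δ} d_σ` ("`T` acts on `V(Σ)` through
  the character `[Σ]`").
* `mem_pohlmannDivisorSets_of_forall_conjugate_mem` — **Lemma 3.8's bookkeeping**: a `2p`-set `Δ` of
  embeddings closed under `σ ↦ σ̄` is a disjoint union of `p` conjugate pairs `{σ, σ̄}`, each a balanced
  pair of Pohlmann's ("`[Σ] = 0 ⟹ V(Σ) = ⊗ᵢ (V_{ξᵢ} ⊗ V_{ξ_{m+i}})^{⊗nᵢ}`").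
* **`mem_divisorClassesSpan_of_forall_exteriorPullback_eq`** — Prop. 3.4 with Prop. 3.3 in this case:
  a class `x ∈ H^{2p}(A(ℂ); ℂ)` with `⋀^{2p}u (x) = x` for all `u ∈ S(A)(ℂ)` lies in
  `Dᵖ(A) ⊗ ℂ = divisorClassesSpan A.X (dim A) p`. Proof: the `u_φ` force the support of `x` in the
  monomial basis to consist of conjugation-closed `Δ`; and `Dᵖ ⊗ ℂ = ⊕_{Δ} ℂ v_Δ` over the disjoint
  unions of balanced pairs (the tree's `Pohlmann1968.divisorClassesSpan_eq_iSup_cmEigenclasses`, which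
  supplies the degree-`2` input Prop. 3.3 — `H²(A)^{S(A)}` is spanned by divisor classes — in the form
  "`v_σ ∧ v_σ̄ ∈ B¹(A) ⊗ ℂ`", Pohlmann's Theorem 1 at `p = 1`).
* **`specialLefschetzGroup_invariants_le_of_isCMTypeRealisation`** — the conclusion of the record
  `Milne1999_specialLefschetzGroup_invariants_le` for such `A`: every class of `H^{2p}(A(ℂ); ℂ)` fixed by
  `specialLefschetzGroup (dim A) A.X` lies in `divisorClassesSpan A.X (dim A) p` (the Künneth family
  `⋀•(u^{⊕(a+1)})` of `u ∈ S(A)(ℂ)` is an element of `specialLefschetzGroup`, the tree's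
  `exteriorPullbackEquiv_mem_specialLefschetzGroup`, Thm. 4.4); `setOf_forall_apply_eq_self_eq_divisorClassesSpan_of_isCMTypeRealisation`
  (Cor. 4.5 as an equality of sets) and `isDivisorGenerated_of_hodgeGroup_eq_specialLefschetzGroup_of_isCMTypeRealisation`
  (Prop. 4.8 (c) ⇒ (a), unconditional for such `A`); `…_of_isCMTyped` for the tree's `IsCMTyped`-style
  data with commutative `End(A)`.

NOT here: the general case of the record (`A` arbitrary: Prop. 3.6, invariant theory of `Sp`, `O`, `GL`
over `C(A)`; reduction to simple factors, Prop. 1.5 / Cor. 4.7) — it remains the cited record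
`Milne1999_specialLefschetzGroup_invariants_le`.

## References

* [Milne1999LefschetzClasses] J. S. Milne, Lefschetz classes on abelian varieties, Duke Math. J. 96
  (1999) 639–675: Thm. 3.2, Props. 3.3–3.4, Lemma 3.8 and p. 657 (the torus case), Def. 4.3, Thm. 4.4,
  Cor. 4.5 (p. 659).
* [Pohlmann1968] H. Pohlmann, Algebraic cycles on abelian varieties of complex multiplication type,
  Ann. of Math. (2) 88 (1968) 161–180, Thm. 1.
* [Gordon1999HodgeAVSurvey] B. B. Gordon, A survey of the Hodge conjecture for abelian varieties, §9.2,
  9.2.2.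
* [Shimura1998] G. Shimura, Abelian Varieties with Complex Multiplication and Modular Functions (1998),
  §6.2 Thm. 4 (3) (Rosati involution = complex conjugation on `K`).
-/

noncomputable section

open CategoryTheory NumberField
open Literature.AlgebraicTopology.SingularHomology
open Literature.AlgebraicGeometry.HodgeTheory
open Literature.AlgebraicGeometry.Motives
open Literature.AlgebraicGeometry.ComplexMultiplication (IsCMTypeRealisation)
open Literature.AlgebraicGeometry.VanGeemen1994 (hodgeClassSpan)
open Literature.AlgebraicGeometry.Pohlmann1968
open Literature.Barriers.HodgeConjecture (divisorClassesSpan)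
open Literature.Geometry.Kaehler (lefschetzPow)
open NumberField.ComplexEmbedding (conjugate)

namespace Literature.AlgebraicGeometry.Milne1999

/-! ### §1 Linear algebra: supports of vectors fixed by a diagonalisable operator -/

section LinearAlgebra

variable {I M : Type*} [Fintype I] [AddCommGroup M] [Module ℂ M]

/-- If `f` is diagonal on the basis `b` with eigenvalues `c i` and `f x = x`, then the `b`-coordinates of
`x` vanish at every `i` with `c i ≠ 1` ("`(V^{⊗n})^T = ⊕_{[Σ]=0} V(Σ)`"). [cite: Milne1999LefschetzClasses, §3 Lemma 3.8 (proof)] -/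
theorem repr_eq_zero_of_apply_eq_smul_of_apply_eq_self (b : Module.Basis I ℂ M) {f : M →ₗ[ℂ] M}
    {c : I → ℂ} (hf : ∀ i, f (b i) = c i • b i) {x : M} (hx : f x = x) {i : I} (hi : c i ≠ 1) :
    b.repr x i = 0 := by
  have h1 : f x = ∑ j, (b.repr x j * c j) • b j := by
    conv_lhs => rw [← b.sum_repr x]
    simp only [map_sum, map_smul, hf, smul_smul]
  have hx' : ∑ j, (b.repr x j * c j - b.repr x j) • b j = 0 := by
    simp only [sub_smul]
    rw [Finset.sum_sub_distrib, ← h1, b.sum_repr x, hx, sub_self]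
  have h := Fintype.linearIndependent_iff.1 b.linearIndependent _ hx' i
  rw [← mul_sub_one, mul_eq_zero] at h
  rcases h with h | h
  · exact h
  · exact absurd (sub_eq_zero.1 h) hi

end LinearAlgebra

/-! ### §2 Weights: `⋀ᵈ u` on the eigen-monomials -/

section Weights

variable {A : AbelianVariety ℂ} {I : Type} [LinearOrder I] {d : ℕ} {v : I → complexBetti A.X 1}
  {b : Module.Basis (Set.powersetCard I d) ℂ (complexBetti A.X d)}

/-- The underlying `d`-set of `s` is the image of its increasing enumeration. [folklore] -/
private theorem powersetCard_val_eq_map (s : Set.powersetCard I d) :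
    (s : Finset I) = Finset.univ.map (Set.powersetCard.ofFinEmbEquiv.symm s).toEmbedding := by
  rw [Set.powersetCard.ofFinEmbEquiv_symm_apply, Finset.map_orderEmbOfFin_univ]

/-- **`⋀ᵈL` acts on the cup monomial `v_s = v_{i₁} ⌣ ⋯ ⌣ v_{i_d}` of a family on which `L` is diagonal,
`L v_i = μ_i v_i`, by the monomial `∏_{i ∈ s} μ_i`** (`⋀ᵈL (v₀ ⌣ ⋯) = L v₀ ⌣ ⋯`, multilinearity) — the
weight `[Σ] = Σ nᵢ ξᵢ` of `T` on `V(Σ)`. [cite: Milne1999LefschetzClasses, §3 Lemma 3.8 (proof)] -/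
theorem exteriorPullback_monomial_eq_prod_smul
    (hb : ∀ s, b s = cupPowOne ℂ (ComplexPoints A.X) d (fun j => v (Set.powersetCard.ofFinEmbEquiv.symm s j)))
    (L : complexBetti A.X 1 →ₗ[ℂ] complexBetti A.X 1) {μ : I → ℂ} (hμ : ∀ i, L (v i) = μ i • v i)
    (s : Set.powersetCard I d) :
    exteriorPullback (AbelianVariety.hasExteriorCohomologyH1_complexPoints A) L d (b s) =
      (∏ i ∈ (s : Finset I), μ i) • b s := by
  rw [hb s, exteriorPullback_cupPowOne]
  simp_rw [hμ]
  rw [MultilinearMap.map_smul_univ, powersetCard_val_eq_map s, Finset.prod_map]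
  rfl

end Weights

/-! ### §3 Lemma 3.8's bookkeeping: conjugation-closed sets are disjoint unions of conjugate pairs -/

section Bookkeeping

variable {K : Type} [Field K] [NumberField K] [IsCMField K]

omit [NumberField K] [IsCMField K] in
/-- An embedding in (or out of) a CM type differs from its conjugate (`φ ∈ Φ ↔ φ̄ ∉ Φ`). [folklore] -/
private theorem conjugate_ne' (Φ : CMType K) (s : K →+* ℂ) : conjugate s ≠ s := by
  intro h
  have h2 := Φ.2 s
  rw [h] at h2
  exact iff_not_self h2

/-- **A `2m`-set of complex embeddings closed under conjugation is a disjoint union of `m` conjugate pairs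
`{σ, σ̄}`, each a balanced pair** (`∈ pohlmannDivisorSets Φ m`): the combinatorial content of Lemma 3.8
("`[Σ] = 0` if and only if `nᵢ = n_{m+i}`", "`V(Σ) = ⊗ᵢ (V_{ξᵢ} ⊗ V_{ξ_{m+i}})^{⊗nᵢ}`") in the index sets
of the tree's `Pohlmann1968/DivisorClassesCMType`. [cite: Milne1999LefschetzClasses, §3 Lemma 3.8] -/
theorem mem_pohlmannDivisorSets_of_forall_conjugate_mem (Φ : CMType K) :
    ∀ (m : ℕ) (Δ : Finset (K →+* ℂ)), Δ.card = 2 * m → (∀ φ ∈ Δ, conjugate φ ∈ Δ) →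
      Δ ∈ pohlmannDivisorSets Φ m := by
  classical
  intro m
  induction m with
  | zero =>
    intro Δ hcard _
    rw [pohlmannDivisorSets_def, mem_disjointUnionsOf_zero]
    exact Finset.card_eq_zero.1 hcard
  | succ m ih =>
    intro Δ hcard hΔc
    obtain ⟨φ, hφ⟩ : Δ.Nonempty := by
      rw [← Finset.card_pos, hcard]; omega
    set t : Finset (K →+* ℂ) := {φ, conjugate φ} with ht_def
    have ht : t ∈ pohlmannSets Φ 1 := pair_conjugate_mem_pohlmannSets_one Φ φ
    have htΔ : t ⊆ Δ := by
      intro x hx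
      rw [ht_def, Finset.mem_insert, Finset.mem_singleton] at hx
      rcases hx with rfl | rfl
      · exact hφ
      · exact hΔc φ hφ
    have hdisj : Disjoint (Δ \ t) t := Finset.sdiff_disjoint
    have hΔeq : Δ = (Δ \ t).disjUnion t hdisj := by
      rw [Finset.disjUnion_eq_union, Finset.sdiff_union_of_subset htΔ]
    have hcard' : (Δ \ t).card = 2 * m := by
      rw [Finset.card_sdiff_of_subset htΔ, hcard, ht.1]; omega
    have hΔ'c : ∀ ψ ∈ Δ \ t, conjugate ψ ∈ Δ \ t := by
      intro ψ hψ
      rw [Finset.mem_sdiff] at hψ ⊢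
      refine ⟨hΔc ψ hψ.1, fun hψt => hψ.2 ?_⟩
      rw [ht_def, Finset.mem_insert, Finset.mem_singleton] at hψt ⊢
      rcases hψt with h | h
      · exact Or.inr (h ▸ (star_star ψ).symm)
      · exact Or.inl (star_injective h)
    rw [hΔeq, pohlmannDivisorSets_def, mem_disjointUnionsOf_succ]
    exact ⟨Δ \ t, (pohlmannDivisorSets_def Φ m) ▸ ih (Δ \ t) hcard' hΔ'c, t, ht, hdisj, rfl⟩

end Bookkeeping

/-! ### §4 The cocharacters of the torus `S(A)` of a CM realisation -/

section Torus

variable {K : Type} [Field K] [NumberField K] [IsCMField K] {Φ : CMType K} {A : AbelianVariety ℂ}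
  {ι : 𝓞 K →+* End A} {θ : K →+* Module.End ℂ (complexBetti A.X 1)} {h : complexBetti A.X 2}
  {v : Module.Basis (K →+* ℂ) ℂ (complexBetti A.X 1)}

/-- **The cocharacters of `S(A)`: for every `φ`, the diagonal automorphism `u_φ` of `H¹(A(ℂ); ℂ)` with
eigenvalue `2` on `H¹_φ`, `2⁻¹` on `H¹_φ̄` and `1` elsewhere lies in `S(A)(ℂ)`** — for a realisation of a
CM type with `θ(K) ⊆ C(A)` and a Rosati-compatible polarization class `h`: it commutes with `θ(K)` (both
are diagonal on the eigenbasis), hence lies in `C(A) ⊗ ℂ` (`centralizer_range_le_centralizerAlgebra`), and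
its eigenvalues satisfy `d_σ d_σ̄ = 1` (`mem_unitaryCentralizerGroup_of_eigenvalues`). Moreover its weight on
a set `Δ` of embeddings, `∏_{σ ∈ Δ} d_σ`, is `1` only if `φ ∈ Δ ⟺ φ̄ ∈ Δ` — "the character group of `S(A)`
has generators `{ξ_{φ₁}, …, ξ_{ιφ_m}}` and defining relations `ξ_{φᵢ} + ξ_{ιφᵢ} = 0`", in dual form.
[cite: Milne1999LefschetzClasses, §3 p. 657 (the torus `S(A)`, characters `ξ_σ`) and §1 p. 645 (`S₀(A)`)]
[cite: Milne1999, §2 Prop. 2.5 (proof)] -/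
theorem exists_torusElement_unitaryCentralizerGroup (hA : IsCMTypeRealisation Φ A ι θ)
    (hθ : ∀ a : K, θ a ∈ centralizerAlgebra A)
    (hv : ∀ (σ : K →+* ℂ) (a : K), θ a (v σ) = σ a • v σ)
    (hv' : ∀ (σ : K →+* ℂ) (a : 𝓞 K), complexBetti.map (ι a).hom.hom.hom 1 (v σ) = σ (a : K) • v σ)
    (hros : ∀ (a ac : 𝓞 K), (ac : K) = IsCMField.complexConj K (a : K) → ∀ x y : complexBetti A.X 1,
      polarizationPairingOne A.X h (A.dim - 1) (complexBetti.map (ι a).hom.hom.hom 1 x) y =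
        polarizationPairingOne A.X h (A.dim - 1) x (complexBetti.map (ι ac).hom.hom.hom 1 y))
    (φ : K →+* ℂ) :
    ∃ u ∈ unitaryCentralizerGroup A h, ∃ d : (K →+* ℂ) → ℂ, (∀ σ, u (v σ) = d σ • v σ) ∧
      ∀ s : Finset (K →+* ℂ), ∏ σ ∈ s, d σ = 1 → (φ ∈ s ↔ conjugate φ ∈ s) := by
  classical
  have hne : conjugate φ ≠ φ := conjugate_ne' Φ φ
  -- the weights `d_σ`: `2` at `φ`, `2⁻¹` at `φ̄`, `1` elsewhere
  set d : (K →+* ℂ) → ℂ := fun σ =>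
    (if σ = φ then (2 : ℂ) else 1) * (if σ = conjugate φ then (2 : ℂ)⁻¹ else 1) with hd_def
  have hd0 : ∀ σ, d σ ≠ 0 := fun σ => by
    simp only [hd_def]
    split_ifs <;> norm_num
  -- the diagonal automorphism `u (v σ) = d σ • v σ`
  set w : (K →+* ℂ) → ℂˣ := fun σ => Units.mk0 (d σ) (hd0 σ) with hw_def
  set u : complexBetti A.X 1 ≃ₗ[ℂ] complexBetti A.X 1 := v.equiv (v.unitsSMul w) (Equiv.refl _) with hu_def
  have hd : ∀ σ, u (v σ) = d σ • v σ := fun σ => by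
    rw [hu_def, Module.Basis.equiv_apply, Equiv.refl_apply, Module.Basis.unitsSMul_apply, Units.smul_def,
      hw_def, Units.val_mk0]
  -- `u` commutes with `θ(K)` (both diagonal), hence `u ∈ C(A)` since `θ(K) ⊆ C(A)`
  have hcen : (u : Module.End ℂ (complexBetti A.X 1)) ∈ Subalgebra.centralizer ℂ (Set.range θ) := by
    rw [Subalgebra.mem_centralizer_iff]
    rintro _ ⟨a, rfl⟩
    refine v.ext fun σ => ?_
    change θ a (u (v σ)) = u (θ a (v σ))
    rw [hd, map_smul, hv, map_smul, hd, smul_comm]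
  have huC : u ∈ centralizerGroup A :=
    mem_centralizerGroup_iff_coe_mem.2 (hA.centralizer_range_le_centralizerAlgebra hθ hcen)
  -- unitarity: `d_σ d_σ̄ = 1`
  have hconj1 : ∀ σ : K →+* ℂ, conjugate σ = φ ↔ σ = conjugate φ := fun σ =>
    ⟨fun e => by rw [← e]; exact (star_star σ).symm, fun e => by rw [e]; exact star_star φ⟩
  have hconj2 : ∀ σ : K →+* ℂ, conjugate σ = conjugate φ ↔ σ = φ := fun σ =>
    ⟨fun e => star_injective e, fun e => by rw [e]⟩
  have h1 : ∀ σ, d σ * d (conjugate σ) = 1 := fun σ => by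
    simp only [hd_def, hconj1 σ, hconj2 σ]
    by_cases hσ : σ = φ
    · subst hσ
      rw [if_pos rfl, if_neg hne.symm, if_neg hne.symm, if_pos rfl]
      norm_num
    · by_cases hσ' : σ = conjugate φ
      · rw [if_neg hσ, if_pos hσ', if_pos hσ', if_neg hσ]
        norm_num
      · rw [if_neg hσ, if_neg hσ', if_neg hσ', if_neg hσ]
        norm_num
  refine ⟨u, mem_unitaryCentralizerGroup_of_eigenvalues hv' hros huC hd h1, d, hd, fun s hs => ?_⟩
  -- the weight on `s`: `2^{[φ ∈ s]} · 2^{-[φ̄ ∈ s]}`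
  have hprod : ∏ σ ∈ s, d σ =
      (if φ ∈ s then (2 : ℂ) else 1) * (if conjugate φ ∈ s then (2 : ℂ)⁻¹ else 1) := by
    simp only [hd_def]
    rw [Finset.prod_mul_distrib, Finset.prod_ite_eq', Finset.prod_ite_eq']
  rw [hprod] at hs
  by_cases hφ : φ ∈ s <;> by_cases hφ' : conjugate φ ∈ s
  · exact ⟨fun _ => hφ', fun _ => hφ⟩
  · rw [if_pos hφ, if_neg hφ'] at hs; norm_num at hs
  · rw [if_neg hφ, if_pos hφ'] at hs; norm_num at hs
  · exact ⟨fun h => absurd h hφ, fun h => absurd h hφ'⟩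

end Torus

/-! ### §5 Prop. 3.4 with Prop. 3.3 for a simple CM abelian variety: `S(A)`-invariants are divisor classes -/

section Main

variable {K : Type} [Field K] [NumberField K] [IsCMField K] {Φ : CMType K} {A : AbelianVariety ℂ}
  {ι : 𝓞 K →+* End A} {θ : K →+* Module.End ℂ (complexBetti A.X 1)}

omit [IsCMField K] in
/-- `[K:ℚ]/2 = dim A` for a realisation (`dim H¹ = [K:ℚ] = 2 dim A`). [folklore] -/
private theorem finrank_div_two_eq_dim (hA : IsCMTypeRealisation Φ A ι θ) :
    Module.finrank ℚ K / 2 = A.dim := by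
  have h1 := AbelianVariety.finrank_complexBetti_one A
  rw [hA.2.1] at h1
  omega

omit [IsCMField K] in
/-- A realisation has positive dimension (`[K:ℚ] ≥ 1`). [folklore] -/
private theorem dim_pos_of_isCMTypeRealisation (hA : IsCMTypeRealisation Φ A ι θ) : 0 < A.dim := by
  have h1 := AbelianVariety.finrank_complexBetti_one A
  rw [hA.2.1] at h1
  have h2 : 0 < Module.finrank ℚ K := Module.finrank_pos
  omega

/-- **Milne 1999, Prop. 3.4 with Prop. 3.3 (Theorem 3.2, `r = 1`) for a realisation of a CM type with
`θ(K) ⊆ C(A)` and a Rosati-compatible polarization class `h`**: a class `x ∈ H^{2p}(A(ℂ); ℂ)` fixed by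
`⋀^{2p} u` for every `u ∈ S(A)(ℂ) = unitaryCentralizerGroup A h` lies in `Dᵖ(A) ⊗ ℂ`. Proof (the torus
argument of p. 657): in the eigen-monomial basis `v_Δ` of `H^{2p} = ⋀^{2p} H¹` the cocharacter `u_φ` of §4
multiplies `v_Δ` by `2^{[φ ∈ Δ] - [φ̄ ∈ Δ]}`, so the support of `x` consists of conjugation-closed `Δ`
(Lemma 3.8), i.e. of disjoint unions of conjugate pairs; and `Dᵖ(A) ⊗ ℂ` is the sum of the eigen-lines
`ℂ v_Δ` over the disjoint unions of balanced pairs (`Pohlmann1968.divisorClassesSpan_eq_iSup_cmEigenclasses`,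
whose degree-`2` input — `v_σ ∧ v_σ̄ ∈ B¹(A) ⊗ ℂ` — is Prop. 3.3 here).
[cite: Milne1999LefschetzClasses, Thm. 3.2, Props. 3.3–3.4, Lemma 3.8 and p. 657] [cite: Pohlmann1968, Thm. 1] -/
theorem mem_divisorClassesSpan_of_forall_exteriorPullback_eq (hA : IsCMTypeRealisation Φ A ι θ)
    (hθ : ∀ a : K, θ a ∈ centralizerAlgebra A) {h : complexBetti A.X 2}
    (hros : ∀ (a ac : 𝓞 K), (ac : K) = IsCMField.complexConj K (a : K) → ∀ x y : complexBetti A.X 1,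
      polarizationPairingOne A.X h (A.dim - 1) (complexBetti.map (ι a).hom.hom.hom 1 x) y =
        polarizationPairingOne A.X h (A.dim - 1) x (complexBetti.map (ι ac).hom.hom.hom 1 y))
    (p : ℕ) (x : complexBetti A.X (2 * p))
    (hx : ∀ u ∈ unitaryCentralizerGroup A h,
      exteriorPullback (AbelianVariety.hasExteriorCohomologyH1_complexPoints A)
        (u : complexBetti A.X 1 →ₗ[ℂ] complexBetti A.X 1) (2 * p) x = x) :
    x ∈ divisorClassesSpan A.X A.dim p := by
  classical
  letI : LinearOrder (K →+* ℂ) :=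
    LinearOrder.lift' (Fintype.equivFin (K →+* ℂ)) (Fintype.equivFin (K →+* ℂ)).injective
  obtain ⟨v, hv, hv'⟩ := Deligne1982.exists_eigenbasis_of_isCMTypeRealisation hA
  obtain ⟨b, hb⟩ := exists_monomialBasis v (2 * p)
  -- the support of `x` in the monomial basis consists of conjugation-closed sets
  have hsupp : ∀ s : Set.powersetCard (K →+* ℂ) (2 * p), b.repr x s ≠ 0 →
      ∀ φ ∈ (s : Finset (K →+* ℂ)), conjugate φ ∈ (s : Finset (K →+* ℂ)) := by
    intro s hs φ hφ
    obtain ⟨u, hu, d, hd, hiff⟩ := exists_torusElement_unitaryCentralizerGroup hA hθ hv hv' hros φ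
    have hdiag : ∀ t, exteriorPullback (AbelianVariety.hasExteriorCohomologyH1_complexPoints A)
        (u : complexBetti A.X 1 →ₗ[ℂ] complexBetti A.X 1) (2 * p) (b t) =
          (∏ σ ∈ (t : Finset (K →+* ℂ)), d σ) • b t :=
      exteriorPullback_monomial_eq_prod_smul hb _ (fun σ => by rw [LinearEquiv.coe_coe, hd])
    have h1 : ∏ σ ∈ (s : Finset (K →+* ℂ)), d σ = 1 := by
      by_contra hne
      exact hs (repr_eq_zero_of_apply_eq_smul_of_apply_eq_self b hdiag (hx u hu) hne)
    exact (hiff _ h1).1 hφ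
  -- `Dᵖ ⊗ ℂ` is the span of the monomials over the disjoint unions of balanced pairs
  have hS : ∀ Δ ∈ pohlmannDivisorSets Φ p, Δ.card = 2 * p := fun Δ hΔ => by
    rw [pohlmannDivisorSets_def] at hΔ
    exact card_of_mem_disjointUnionsOf (fun t ht => card_eq_two_of_mem_pohlmannSets_one ht) hΔ
  rw [← finrank_div_two_eq_dim hA, divisorClassesSpan_eq_iSup_cmEigenclasses hA p,
    iSup_cmEigenclasses_eq_span_image hA hv hb hS, Module.Basis.mem_span_image]
  intro s hs
  exact mem_pohlmannDivisorSets_of_forall_conjugate_mem Φ p s s.2 (hsupp s (Finsupp.mem_support_iff.1 hs))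

/-- **The same for ANY polarization class** `h'` (rational, with a Kähler multiple `s · h'`, `s > 0` — the
record's spelling): `S(A)(ℂ)` does not depend on the polarization (Milne p. 643 "independent of the
choice of `D`"; the tree's `unitaryCentralizerGroup_eq_of_isKaehlerClass`), so invariance under
`⋀^{2p} u` for all `u ∈ unitaryCentralizerGroup A h'` already forces `x ∈ Dᵖ(A) ⊗ ℂ`.
[cite: Milne1999LefschetzClasses, §1 pp. 643–644, Thm. 3.2 and p. 657] [cite: Shimura1998, §6.2 Theorem 4 (3)] -/
theorem mem_divisorClassesSpan_of_forall_exteriorPullback_eq_of_isKaehlerClass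
    (hA : IsCMTypeRealisation Φ A ι θ) (hθ : ∀ a : K, θ a ∈ centralizerAlgebra A)
    {h' : complexBetti A.X 2} (hQ' : IsRationalClass h')
    (hK' : ∃ s : ℝ, 0 < s ∧ IsKaehlerClass A.dim A.X ((s : ℂ) • h')) (p : ℕ) (x : complexBetti A.X (2 * p))
    (hx : ∀ u ∈ unitaryCentralizerGroup A h',
      exteriorPullback (AbelianVariety.hasExteriorCohomologyH1_complexPoints A)
        (u : complexBetti A.X 1 →ₗ[ℂ] complexBetti A.X 1) (2 * p) x = x) :
    x ∈ divisorClassesSpan A.X A.dim p := by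
  obtain ⟨h, hQ, -, ⟨s, hs, hK⟩, hros⟩ := hA.exists_rosati_kaehlerClass
  -- `S(A)(ℂ)` for the Rosati class `h` (or `-h`, a positive multiple of a Kähler class) is `S(A)(ℂ)` for `h'`
  have key : unitaryCentralizerGroup A h = unitaryCentralizerGroup A h' := by
    rcases lt_or_gt_of_ne hs with hneg | hpos
    · have hQn : IsRationalClass ((((-1 : ℚ) : ℂ)) • h) := hQ.smul (-1)
      have hsm : (((-s : ℝ) : ℂ)) • ((((-1 : ℚ) : ℂ)) • h) = ((s : ℂ)) • h := by
        rw [smul_smul]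
        congr 1
        push_cast
        ring
      have hKn : IsKaehlerClass A.dim A.X ((((-s : ℝ) : ℂ)) • ((((-1 : ℚ) : ℂ)) • h)) := by
        rw [hsm]; exact hK
      rw [← unitaryCentralizerGroup_smul (show (((-1 : ℚ) : ℂ)) ≠ 0 by norm_num) h]
      exact unitaryCentralizerGroup_eq_of_isKaehlerClass hQn ⟨-s, by linarith, hKn⟩ hQ' hK'
    · exact unitaryCentralizerGroup_eq_of_isKaehlerClass hQ ⟨s, hpos, hK⟩ hQ' hK'
  exact mem_divisorClassesSpan_of_forall_exteriorPullback_eq hA hθ hros p x fun u hu => hx u (key ▸ hu)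

/-- **The conclusion of the record `Milne1999_specialLefschetzGroup_invariants_le` (Milne 1999, Cor. 4.5
with Thm. 4.4 and Thm. 3.2) PROVED for a realisation of a CM type with `θ(K) ⊆ C(A)`** (`End⁰(A) = K`; a
simple complex abelian variety of CM type): every class `x ∈ H^{2p}(A(ℂ); ℂ)` fixed by every element of
`specialLefschetzGroup (dim A) A.X` lies in `Dᵖ_hom(A)_ℂ = divisorClassesSpan A.X (dim A) p`. The Künneth
family `⋀•(u^{⊕(a+1)})` of `u ∈ S(A)(ℂ)` (for a Rosati-compatible polarization class, Shimura §6.2 Thm. 4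
(3): `IsCMTypeRealisation.exists_rosati_kaehlerClass`) lies in `specialLefschetzGroup`
(`exteriorPullbackEquiv_mem_specialLefschetzGroup`, Thm. 4.4), so the hypothesis gives `⋀^{2p}u (x) = x`
and `mem_divisorClassesSpan_of_forall_exteriorPullback_eq` applies.
[cite: Milne1999LefschetzClasses, Cor. 4.5 and p. 659, Thm. 3.2 and p. 657] [cite: Shimura1998, §6.2 Theorem 4 (3)] -/
theorem specialLefschetzGroup_invariants_le_of_isCMTypeRealisation (hA : IsCMTypeRealisation Φ A ι θ)
    (hθ : ∀ a : K, θ a ∈ centralizerAlgebra A) (p : ℕ) (x : complexBetti A.X (2 * p))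
    (hx : ∀ g ∈ specialLefschetzGroup A.dim A.X, g (2 * p) x = x) :
    x ∈ divisorClassesSpan A.X A.dim p := by
  obtain ⟨h, hQ, -, ⟨s, hs, hK⟩, hros⟩ := hA.exists_rosati_kaehlerClass
  have hA0 : 0 < A.dim := dim_pos_of_isCMTypeRealisation hA
  have hh : h ∈ hodgeClassSpan A.dim A.X 1 := mem_hodgeClassSpan_one_of_isKaehlerClass_smul hQ hs hK
  have htop : lefschetzPow h (A.dim - 1) 2 h ≠ 0 := lefschetzPow_self_ne_zero_of_isKaehlerClass_smul hA0 hK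
  have hnd : ∀ x : complexBetti A.X 1, (∀ y, polarizationPairingOne A.X h (A.dim - 1) x y = 0) → x = 0 :=
    eq_zero_of_forall_polarizationPairingOne_eq_zero_of_isKaehlerClass_smul' hs hK
  refine mem_divisorClassesSpan_of_forall_exteriorPullback_eq hA hθ hros p x fun u hu => ?_
  exact hx _ (exteriorPullbackEquiv_mem_specialLefschetzGroup hA0 hh htop hnd hu)

/-- **Cor. 4.5 as an equality of sets, for a simple CM abelian variety**: the `S(A)`-invariants of
`H^{2p}(A(ℂ); ℂ)` are EXACTLY `Dᵖ_hom(A)_ℂ` (the converse inclusion is definitional,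
`apply_eq_self_of_mem_specialLefschetzGroup`). [cite: Milne1999LefschetzClasses, Cor. 4.5 (p. 659)] -/
theorem setOf_forall_apply_eq_self_eq_divisorClassesSpan_of_isCMTypeRealisation
    (hA : IsCMTypeRealisation Φ A ι θ) (hθ : ∀ a : K, θ a ∈ centralizerAlgebra A) (p : ℕ) :
    {x : complexBetti A.X (2 * p) | ∀ g ∈ specialLefschetzGroup A.dim A.X, g (2 * p) x = x} =
      (divisorClassesSpan A.X A.dim p : Set _) :=
  Set.Subset.antisymm (fun x hx => specialLefschetzGroup_invariants_le_of_isCMTypeRealisation hA hθ p x hx)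
    fun _ hx _ hg => apply_eq_self_of_mem_specialLefschetzGroup hg hx

/-- **Milne Prop. 4.8, (c) ⇒ (a) on `A` itself, unconditionally for a simple CM abelian variety**: if
`Hg′(A) = S(A)` then every rational `(p,p)`-class of `A` is fixed by `S(A)`, hence lies in `Dᵖ ⊗ ℂ` —
`IsDivisorGenerated A` (no exotic Hodge class on `A`); the record-free form of the tree's
`AbelianVariety.isDivisorGenerated_of_hodgeGroup_eq_specialLefschetzGroup` for such `A`.
[cite: Milne1999LefschetzClasses, Prop. 4.8 and Cor. 4.5 (pp. 659–660)] -/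
theorem isDivisorGenerated_of_hodgeGroup_eq_specialLefschetzGroup_of_isCMTypeRealisation
    (hA : IsCMTypeRealisation Φ A ι θ) (hθ : ∀ a : K, θ a ∈ centralizerAlgebra A)
    (hHg : hodgeGroup A.dim A.X = specialLefschetzGroup A.dim A.X) : IsDivisorGenerated A :=
  fun p c hc hpp => specialLefschetzGroup_invariants_le_of_isCMTypeRealisation hA hθ p c
    fun _ hg => apply_eq_self_of_mem_hodgeGroup (hHg ▸ hg) hc hpp

/-- **The same for a realisation whose endomorphism ring is commutative** (`End⁰(A) = K` is then forced;
the case of a SIMPLE complex abelian variety of CM type, `End⁰(A)` a CM field of degree `2 dim A`):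
the `S(A)`-invariants of `H^{2p}(A(ℂ); ℂ)` are divisor classes.
[cite: Milne1999LefschetzClasses, Thm. 3.2 and p. 657, Cor. 4.5] [cite: Milne1999, §2 p. 54] -/
theorem specialLefschetzGroup_invariants_le_of_isCMTypeRealisation_of_comm (hA : IsCMTypeRealisation Φ A ι θ)
    (hEnd : ∀ φ ψ : A ⟶ A, φ ≫ ψ = ψ ≫ φ) (p : ℕ) (x : complexBetti A.X (2 * p))
    (hx : ∀ g ∈ specialLefschetzGroup A.dim A.X, g (2 * p) x = x) :
    x ∈ divisorClassesSpan A.X A.dim p :=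
  specialLefschetzGroup_invariants_le_of_isCMTypeRealisation hA (hA.theta_mem_centralizerAlgebra_of_comm hEnd)
    p x hx

end Main

end Literature.AlgebraicGeometry.Milne1999

end
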